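import Mathlib.Algebra.MvPolynomial.Basic
import Mathlib.LinearAlgebra.Matrix.Permanent
import Mathlib.Data.Finsupp.Basic
import Mathlib.Algebra.BigOperators.Fin
import Mathlib.Data.Nat.Factorial.BigOperators
import Literature.LinearAlgebra.Matrix.PermanentLaplace
import HarnessLib

/-!
# Polarisation identity: permanents of coefficient lookups are scaled coefficients of products of linear forms

Mathematical layer (Finset sums, `Matrix.permanent`, `MvPolynomial.coeff`) of the Lean checker of
the GCT multiplicity-obstruction engine (cell `pub-gct`; honest framing: rung-1
multiplicity-obstruction search for permanent versus determinant at small `(n, m)`, no claim about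
VP ≠ VNP or P ≠ NP). The kernel evaluator `TableauEval.evalC` (`PlethysmTableauEvaluation.lean`)
reads the symmetric-tensor entry `q̂(α) = α! · c_α` of a form `q = ∑_α c_α x^α` presented as a
sum of products of linear forms `q = ∑_t c_t ∏_{s<m} ℓ_{t,s}` through the **polarisation identity**

  `∑_t c_t · perm (ℓ_{t,s}[w_{s'}])_{s,s' < m} = α(w)! · coeff_{α(w)} q`

for every word `w : Fin m → σ` of content `α(w) = ∑_s e_{w s}` (`α! := ∏_v (α v)!`). Here it is
PROVED (`permanent_lookup_eq_ffact_mul_coeff`, `symEntryM_eq`), by induction on `m`: Laplace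
expansion of the permanent along the first row (tree: `Matrix.permanent_eq_sum_row_zero`) against
`coeff_α (L · Q) = ∑_v a_v coeff_{α - e_v} Q` (Mathlib `MvPolynomial.coeff_X_mul'`), the fibres
of `w` having the sizes `α(w) v`. Consequence: the value depends on the presentation only through
the form (`symEntryM_congr_form`), which is what makes the certificate's evaluation at
`g · P` presentation-independent. This is the classical statement that the symmetrisation of
`ℓ_1 ⊗ ⋯ ⊗ ℓ_m` is the symmetric tensor of `ℓ_1 ⋯ ℓ_m` (Dörfler–Ikenmeyer–Panova 2020 §5:
"`p = ℓ_1 ⋯ ℓ_n = (1/n!) ∑_σ ℓ_{σ(1)} ⊗ ⋯ ⊗ ℓ_{σ(n)}`"). Elementary [folklore].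
-/

noncomputable section

open scoped BigOperators

namespace Literature.Computability.AlgebraicComplexity

namespace TableauEval

open MvPolynomial

variable {σ : Type*} {K : Type*} [CommRing K]

/-! ## §1 Contents of words and `α!` -/

/-- `α! = ∏_v (α v)!` for a finitely supported exponent vector. [folklore] -/
def ffact (α : σ →₀ ℕ) : ℕ := α.prod fun _ n => n.factorial

/-- The content `α(w) = ∑_s e_{w s}` of a word. [folklore] -/
def wordContent {m : ℕ} (w : Fin m → σ) : σ →₀ ℕ := ∑ s, Finsupp.single (w s) 1

/-- The content counts occurrences: `α(w) v = #{s | w s = v}`. [folklore] -/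
theorem wordContent_apply [DecidableEq σ] {m : ℕ} (w : Fin m → σ) (v : σ) :
    wordContent w v = (Finset.univ.filter fun s => w s = v).card := by
  rw [wordContent, Finsupp.finsetSum_apply, Finset.card_filter]
  refine Finset.sum_congr rfl fun s _ => ?_
  rw [Finsupp.single_apply]

/-- Removing position `s'`: `α(w ∘ s'.succAbove) + e_{w s'} = α(w)`. [folklore] -/
theorem wordContent_succAbove {m : ℕ} (w : Fin (m + 1) → σ) (s' : Fin (m + 1)) :
    (wordContent fun s => w (s'.succAbove s)) + Finsupp.single (w s') 1 = wordContent w := by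
  rw [wordContent, wordContent, Fin.sum_univ_succAbove _ s', add_comm]

/-- `(β + e_v)! = (β v + 1) · β!`. [folklore] -/
theorem ffact_add_single [DecidableEq σ] (β : σ →₀ ℕ) (v : σ) :
    ffact (β + Finsupp.single v 1) = (β v + 1) * ffact β := by
  unfold ffact
  set S := insert v β.support with hS
  have h1 : (β + Finsupp.single v 1).support ⊆ S := by
    intro x hx
    rw [Finsupp.mem_support_iff, Finsupp.add_apply, Finsupp.single_apply] at hx
    rw [hS, Finset.mem_insert, Finsupp.mem_support_iff]
    by_cases h : v = x
    · exact Or.inl h.symm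
    · rw [if_neg h, add_zero] at hx
      exact Or.inr hx
  have h2 : β.support ⊆ S := Finset.subset_insert _ _
  rw [Finsupp.prod_of_support_subset _ h1 _ (fun _ _ => Nat.factorial_zero),
    Finsupp.prod_of_support_subset _ h2 _ (fun _ _ => Nat.factorial_zero)]
  have hv : v ∈ S := Finset.mem_insert_self _ _
  rw [← Finset.mul_prod_erase S _ hv, ← Finset.mul_prod_erase S (fun x => (β x).factorial) hv,
    Finsupp.add_apply, Finsupp.single_eq_same, Nat.factorial_succ, mul_assoc]
  congr 2
  refine Finset.prod_congr rfl fun x hx => ?_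
  rw [Finsupp.add_apply, Finsupp.single_apply, if_neg (Finset.ne_of_mem_erase hx).symm, add_zero]

/-! ## §2 Linear forms, products, and the polarisation identity -/

/-- The linear form with coefficient vector `a`: `∑_v a v · X v` (finitely many `v`). [folklore] -/
def linForm [Fintype σ] (a : σ → K) : MvPolynomial σ K := ∑ v, C (a v) * X v

/-- `coeff_α (L_a · Q) = ∑_v a_v · [α v ≠ 0] · coeff_{α - e_v} Q`. [folklore] -/
theorem coeff_linForm_mul [Fintype σ] [DecidableEq σ] (a : σ → K) (Q : MvPolynomial σ K) (α : σ →₀ ℕ) :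
    coeff α (linForm a * Q) =
      ∑ v, a v * (if v ∈ α.support then coeff (α - Finsupp.single v 1) Q else 0) := by
  unfold linForm
  rw [Finset.sum_mul, coeff_sum]
  refine Finset.sum_congr rfl fun v _ => ?_
  rw [mul_assoc, coeff_C_mul, coeff_X_mul']

/-- **Polarisation identity** (one product of linear forms): for `a : Fin m → σ → K` and a word
`w : Fin m → σ`, `perm (a s (w s'))_{s,s'} = α(w)! · coeff_{α(w)} (∏_s L_{a s})`. Induction on
`m` by first-row Laplace expansion of the permanent. Dörfler–Ikenmeyer–Panova 2020 §5
(symmetrisation of `ℓ_1 ⊗ ⋯ ⊗ ℓ_n`). [folklore] -/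
theorem permanent_lookup_eq_ffact_mul_coeff [Fintype σ] [DecidableEq σ] :
    ∀ {m : ℕ} (a : Fin m → σ → K) (w : Fin m → σ),
      (Matrix.of fun s s' => a s (w s')).permanent =
        (ffact (wordContent w) : K) * coeff (wordContent w) (∏ s, linForm (a s))
  | 0, a, w => by
    have h0 : wordContent w = 0 := by simp [wordContent]
    rw [h0]
    simp [Matrix.permanent_isEmpty, ffact, MvPolynomial.coeff_zero_one]
  | m + 1, a, w => by
    set α := wordContent w with hα
    set Q : MvPolynomial σ K := ∏ s : Fin m, linForm (a s.succ) with hQ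
    have IH : ∀ s' : Fin (m + 1),
        ((Matrix.of fun s s'' : Fin (m + 1) => a s (w s'')).submatrix Fin.succ
            s'.succAbove).permanent =
          (ffact (α - Finsupp.single (w s') 1) : K) * coeff (α - Finsupp.single (w s') 1) Q := by
      intro s'
      have hc : wordContent (fun s => w (s'.succAbove s)) = α - Finsupp.single (w s') 1 := by
        rw [hα, ← wordContent_succAbove w s', add_tsub_cancel_right]
      rw [← hc]
      exact permanent_lookup_eq_ffact_mul_coeff (fun s => a s.succ) fun s => w (s'.succAbove s)
    rw [Matrix.permanent_eq_sum_row_zero, Fin.prod_univ_succ, coeff_linForm_mul, Finset.mul_sum]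
    simp only [Matrix.of_apply, IH]
    rw [← Finset.sum_fiberwise_of_maps_to (s := Finset.univ) (t := Finset.univ)
      (g := fun s' : Fin (m + 1) => w s') (fun _ _ => Finset.mem_univ _)]
    refine Finset.sum_congr rfl fun v _ => ?_
    have hfib : ∑ s' ∈ Finset.univ.filter (fun s' : Fin (m + 1) => w s' = v),
          a 0 (w s') * ((ffact (α - Finsupp.single (w s') 1) : K) *
            coeff (α - Finsupp.single (w s') 1) Q) =
        ∑ s' ∈ Finset.univ.filter (fun s' : Fin (m + 1) => w s' = v),
          a 0 v * ((ffact (α - Finsupp.single v 1) : K) *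
            coeff (α - Finsupp.single v 1) Q) :=
      Finset.sum_congr rfl fun s' hs' => by rw [(Finset.mem_filter.mp hs').2]
    rw [hfib, Finset.sum_const, ← wordContent_apply w v, nsmul_eq_mul]
    by_cases hv : v ∈ α.support
    · rw [if_pos hv]
      have hv1 : 1 ≤ α v := Nat.one_le_iff_ne_zero.mpr (Finsupp.mem_support_iff.mp hv)
      have hαv : α - Finsupp.single v 1 + Finsupp.single v 1 = α :=
        tsub_add_cancel_of_le (Finsupp.single_le_iff.mpr hv1)
      have hf : (ffact α : K) = (α v : K) * ffact (α - Finsupp.single v 1) := by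
        conv_lhs => rw [← hαv, ffact_add_single]
        rw [Nat.cast_mul, Finsupp.tsub_apply, Finsupp.single_eq_same, Nat.sub_add_cancel hv1]
      rw [← hα, hf]
      ring
    · rw [if_neg hv]
      have h0 : α v = 0 := Finsupp.notMem_support_iff.mp hv
      rw [← hα, h0]
      simp

/-- The symmetric-tensor entry of a sum of products of linear forms at a word (mathematical twin
of `TableauEval.symEntry`): `∑_t c_t · perm (ℓ_{t,s}[w_{s'}])`. [folklore] -/
def symEntryM [Fintype σ] {T m : ℕ} (coef : Fin T → K) (form : Fin T → Fin m → σ → K)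
    (w : Fin m → σ) : K :=
  ∑ t, coef t * (Matrix.of fun s s' => form t s (w s')).permanent

/-- The form presented by a sum of products of linear forms: `∑_t c_t ∏_s L_{ℓ_{t,s}}`.
[folklore] -/
def splfPoly [Fintype σ] {T m : ℕ} (coef : Fin T → K) (form : Fin T → Fin m → σ → K) :
    MvPolynomial σ K :=
  ∑ t, C (coef t) * ∏ s, linForm (form t s)

/-- **Polarisation identity**: `symEntryM` is `α(w)!` times the coefficient of `x^{α(w)}` in the
presented form. [folklore] -/
theorem symEntryM_eq [Fintype σ] [DecidableEq σ] {T m : ℕ} (coef : Fin T → K) (form : Fin T → Fin m → σ → K)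
    (w : Fin m → σ) :
    symEntryM coef form w =
      (ffact (wordContent w) : K) * coeff (wordContent w) (splfPoly coef form) := by
  unfold symEntryM splfPoly
  rw [coeff_sum, Finset.mul_sum]
  refine Finset.sum_congr rfl fun t _ => ?_
  rw [coeff_C_mul, permanent_lookup_eq_ffact_mul_coeff]
  ring

/-- **Presentation independence**: two sum-of-products presentations of the same form have the
same symmetric-tensor entries. [folklore] -/
theorem symEntryM_congr_form [Fintype σ] [DecidableEq σ] {T T' m : ℕ} {coef : Fin T → K}
    {form : Fin T → Fin m → σ → K} {coef' : Fin T' → K} {form' : Fin T' → Fin m → σ → K}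
    (h : splfPoly coef form = splfPoly coef' form') (w : Fin m → σ) :
    symEntryM coef form w = symEntryM coef' form' w := by
  rw [symEntryM_eq, symEntryM_eq, h]

end TableauEval

end Literature.Computability.AlgebraicComplexity

end
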